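import Literature.Analysis.FluidPDE.PartialRegularity
import Literature.Analysis.FluidPDE.Seregin2020ScaledEnergyBounds
import Literature.Analysis.FluidPDE.LocalEnergyConcatenation
import Literature.Analysis.FluidPDE.SereginSverakPressureProofs
import Literature.Analysis.FluidPDE.LocalEnergySliceLEI

/-!
# Crux `SelfMixingDichotomy.SequentialTypeIExclusion` (stmt-NavierStokesRegularity-1424), line
  `registered` (r4): STUB `stub_finalTimeTypeISingularPoint` — the final time of a classical
  Leray–Hopf solution under a centred cubic Type-I bound is a centred Type-I singular point of its
  local-energy continuation

Lands `--supports stmt-NavierStokesRegularity-1424` the registered stub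
`stub_finalTimeTypeISingularPoint` of the lead's skeleton
`Cruxes/SequentialTypeIExclusion/Lines/birth.lean` (reshape r4). Let `u` be a classical solution of
Navier–Stokes (`ν = 1`, no force) on `ℝ³ × [0, T)` which is Leray–Hopf on `[0, T]`, and let
`(U, P)` be a local energy solution on `ℝ³ × (0, T')`, `T < T'`, agreeing on `[0, T]` with `u` and
its gauged pressure `q = p − (p(·, 0) − p̃[u](0))`. If `C(r; T, x₀) ≤ M'` for `0 < r < r₁`
(`C = Literature.Analysis.FluidPDE.cknC`, backward cylinders) and `u` is bounded on NO cylinder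
`(T − ρ², T) × B_ρ(x₀)`, then `(T, x₀)` is a centred Type-I singular point of `(U, P)` on the open
slab `(0, T') × ℝ³` (`Literature.Analysis.FluidPDE.IsTypeISingularPoint`).

Proof (every analytic ingredient is proved in the tree):

1. `(U, P)` is suitable on the slab (a field of the local energy class) and `(T, x₀)` lies in the
   open slab as `0 < T < T'`;
2. `(T, x₀)` is not a regular point of `U`: an essential bound on a centred cylinder `Q*_s(T, x₀)`
   is an essential bound on the backward cylinder `Q_ρ(T, x₀)`, `ρ = min s √T`, which lies in
   `[0, T) × ℝ³` where `U = u` is continuous (`SereginSverak2002.continuousOn_uncurry`), hence a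
   pointwise bound (`SereginSverak2002.norm_le_of_ae_restrict_of_continuousOn`) — excluded by
   hypothesis;
3. the weak spatial gradient `G` of the local energy class, restricted with `(U, P)` to the slab
   `(0, T) × ℝ³`; at the scale `r_I = min (r₁/2) √T` the cylinder `Q_{r_I}(T, x₀)` lies in that
   slab, `D(r_I; P) = D(r_I; q) < ∞` (`SereginSverak2002.lintegral_slab_gauged_pressure_lt_top`)
   and `C(r; U) = C(r; u) ≤ M'` for `0 < r ≤ r_I`, so SEREGIN'S BOUND
   (`Seregin2020.scaledEnergies_bounded_of_cknC_le`; Seregin 2020, remark after Def. 1.7) gives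
   `A_ess + E + C + D ≤ K` on `(0, r_I/2]`;
4. the accepted `sup_t` quantity `cknA` is at most `cknAEss` below `T`: `U` being continuous on
   `[0, T) × ℝ³`, `t ↦ r⁻¹ ∫_{B_r(x₀)} |U(t)|²` is sequentially lower semicontinuous on
   `(T − r², T)` (Fatou along a sequence of times), and a function a.e. bounded by `m` on an open
   interval and sequentially lsc is bounded by `m` everywhere on it; hence
   `sup_{0 < r < r_I/2} (A + C + D + E)(r; T, x₀) ≤ K < ∞`.
-/

noncomputable section

-- the summit and its single problem share the name (D-0017 nested layout)
set_option linter.dupNamespace false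

namespace Summit.NavierStokesRegularity.NavierStokesRegularity.Theorems.SequentialTypeIExclusion.Registered

open scoped ENNReal NNReal Topology
open Literature.Analysis.FluidPDE Set Filter MeasureTheory Function Metric

/-- Times of the backward cylinder `Q_r(T, x₀)` with `r² ≤ T` lie in `[0, T]`. -/
private theorem fst_mem_Icc_of_mem_parabolicCylinder {T r : ℝ} (hr : r ^ 2 ≤ T)
    {x₀ : EuclideanSpace ℝ (Fin 3)} {w : ℝ × EuclideanSpace ℝ (Fin 3)}
    (hw : w ∈ parabolicCylinder r ((T, x₀) : ℝ × EuclideanSpace ℝ (Fin 3))) : w.1 ∈ Icc 0 T := by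
  simp only [mem_parabolicCylinder] at hw
  exact ⟨by linarith [hw.1.1], hw.1.2.le⟩

/-- The backward cylinder `Q_r(T, x₀)` with `r² ≤ T` lies in the slab `(0, T) × ℝ³`. -/
private theorem parabolicCylinder_subset_Ioo_prod {T r : ℝ} (hr : r ^ 2 ≤ T)
    (x₀ : EuclideanSpace ℝ (Fin 3)) :
    parabolicCylinder r ((T, x₀) : ℝ × EuclideanSpace ℝ (Fin 3)) ⊆
      Ioo 0 T ×ˢ (univ : Set (EuclideanSpace ℝ (Fin 3))) := by
  intro w hw
  simp only [mem_parabolicCylinder] at hw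
  exact ⟨⟨by linarith [hw.1.1], hw.1.2⟩, mem_univ _⟩

/-- **A sequentially lower semicontinuous function on an open interval is bounded by its essential
supremum everywhere**: if `g t ≤ liminf g(sₙ)` along every sequence `sₙ → t` in `(a, b)`, then
`g t ≤ esssup_{(a, b)} g` (pick `sₙ ∈ (t − 1/(n+1), t)` outside the null exceptional set). -/
private theorem le_essSup_Ioo_of_seq_lsc {a b t : ℝ} {g : ℝ → ℝ≥0∞} (ht : t ∈ Ioo a b)
    (hg : ∀ s : ℕ → ℝ, (∀ n, s n ∈ Ioo a b) → Tendsto s atTop (𝓝 t) →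
      g t ≤ liminf (fun n => g (s n)) atTop) :
    g t ≤ essSup g (volume.restrict (Ioo a b)) := by
  set m : ℝ≥0∞ := essSup g (volume.restrict (Ioo a b))
  have hae : ∀ᵐ s ∂(volume : Measure ℝ), s ∈ Ioo a b → g s ≤ m :=
    (ae_restrict_iff' measurableSet_Ioo).1 (ENNReal.ae_le_essSup g)
  have hpick : ∀ n : ℕ, ∃ s ∈ Ioo (max a (t - 1 / ((n : ℝ) + 1))) t, (s ∈ Ioo a b → g s ≤ m) :=
    fun n => exists_mem_Ioo_of_ae hae (max_lt ht.1 (sub_lt_self _ Nat.one_div_pos_of_nat))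
  choose s hs hsm using hpick
  have hsI : ∀ n, s n ∈ Ioo a b := fun n =>
    ⟨(le_max_left _ _).trans_lt (hs n).1, (hs n).2.trans ht.2⟩
  have hst : Tendsto s atTop (𝓝 t) := by
    have h1 : Tendsto (fun n : ℕ => t - 1 / ((n : ℝ) + 1)) atTop (𝓝 t) := by
      simpa using tendsto_const_nhds.sub (tendsto_one_div_add_atTop_nhds_zero_nat (𝕜 := ℝ))
    exact tendsto_of_tendsto_of_tendsto_of_le_of_le h1 tendsto_const_nhds
      (fun n => ((le_max_right _ _).trans_lt (hs n).1).le) fun n => (hs n).2.le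
  calc g t ≤ liminf (fun n => g (s n)) atTop := hg s hsI hst
    _ ≤ liminf (fun _ : ℕ => m) atTop :=
        liminf_le_liminf (Eventually.of_forall fun n => hsm n (hsI n))
    _ = m := liminf_const m

/-- **Fatou along a sequence of times**: for `U` continuous on `[0, T) × ℝ³`, the scaled local
energy `t ↦ r⁻¹ ∫_{B_r(x₀)} |U(t)|²` is sequentially lower semicontinuous on `[0, T)`. -/
private theorem scaledEnergy_le_liminf {T r : ℝ} (hr : 0 < r)
    {U : ℝ → EuclideanSpace ℝ (Fin 3) → EuclideanSpace ℝ (Fin 3)}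
    (hcont : ContinuousOn (uncurry U) (Ico 0 T ×ˢ (univ : Set (EuclideanSpace ℝ (Fin 3)))))
    (x₀ : EuclideanSpace ℝ (Fin 3)) {t : ℝ} (ht : t ∈ Ico 0 T) {s : ℕ → ℝ}
    (hs : ∀ n, s n ∈ Ico 0 T) (hst : Tendsto s atTop (𝓝 t)) :
    (ENNReal.ofReal r)⁻¹ * ∫⁻ x in ball x₀ r, ‖U t x‖ₑ ^ 2 ≤
      liminf (fun n => (ENNReal.ofReal r)⁻¹ * ∫⁻ x in ball x₀ r, ‖U (s n) x‖ₑ ^ 2) atTop := by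
  have hc : (ENNReal.ofReal r)⁻¹ ≠ ∞ := ENNReal.inv_ne_top.2 (ENNReal.ofReal_pos.2 hr).ne'
  -- pointwise convergence in time, at every `x`
  have hpt : ∀ x, Tendsto (fun n => (ENNReal.ofReal r)⁻¹ * ‖U (s n) x‖ₑ ^ 2) atTop
      (𝓝 ((ENNReal.ofReal r)⁻¹ * ‖U t x‖ₑ ^ 2)) := by
    intro x
    have h1 : Tendsto (fun n => (s n, x)) atTop
        (𝓝[Ico 0 T ×ˢ (univ : Set (EuclideanSpace ℝ (Fin 3)))] (t, x)) :=
      tendsto_nhdsWithin_iff.2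
        ⟨hst.prodMk_nhds tendsto_const_nhds, Eventually.of_forall fun n => ⟨hs n, mem_univ _⟩⟩
    have h2 : Tendsto (fun n => U (s n) x) atTop (𝓝 (U t x)) :=
      (hcont (t, x) ⟨ht, mem_univ _⟩).tendsto.comp h1
    exact ENNReal.Tendsto.const_mul (ENNReal.Tendsto.pow h2.enorm) (Or.inr hc)
  -- every slice below `T` is continuous, hence measurable
  have hmeas : ∀ n, Measurable fun x => (ENNReal.ofReal r)⁻¹ * ‖U (s n) x‖ₑ ^ 2 := by
    intro n
    have hcn : Continuous (U (s n)) :=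
      hcont.comp_continuous (continuous_const.prodMk continuous_id) fun x => ⟨hs n, mem_univ _⟩
    exact (hcn.measurable.enorm.pow_const 2).const_mul _
  rw [← lintegral_const_mul' _ _ hc]
  calc ∫⁻ x in ball x₀ r, (ENNReal.ofReal r)⁻¹ * ‖U t x‖ₑ ^ 2
      = ∫⁻ x in ball x₀ r,
          liminf (fun n => (ENNReal.ofReal r)⁻¹ * ‖U (s n) x‖ₑ ^ 2) atTop :=
        lintegral_congr fun x => (hpt x).liminf_eq.symm
    _ ≤ liminf (fun n => ∫⁻ x in ball x₀ r, (ENNReal.ofReal r)⁻¹ * ‖U (s n) x‖ₑ ^ 2) atTop :=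
        lintegral_liminf_le hmeas
    _ = liminf (fun n => (ENNReal.ofReal r)⁻¹ * ∫⁻ x in ball x₀ r, ‖U (s n) x‖ₑ ^ 2) atTop :=
        congrArg (fun v : ℕ → ℝ≥0∞ => liminf v atTop)
          (funext fun n => lintegral_const_mul' _ _ hc)

/-- **`A ≤ A_ess` below the final time**: for `U` continuous on `[0, T) × ℝ³` and `r² ≤ T`, the
accepted `sup_t` scaled energy `cknA r (T, x₀) U` is at most Albritton–Barker's `esssup_t`
variant `cknAEss r (T, x₀) U` (the converse `cknAEss_le_cknA` holds unconditionally). -/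
private theorem cknA_le_cknAEss_of_continuousOn {T r : ℝ} (hr : 0 < r) (hrT : r ^ 2 ≤ T)
    {U : ℝ → EuclideanSpace ℝ (Fin 3) → EuclideanSpace ℝ (Fin 3)}
    (hcont : ContinuousOn (uncurry U) (Ico 0 T ×ˢ (univ : Set (EuclideanSpace ℝ (Fin 3)))))
    (x₀ : EuclideanSpace ℝ (Fin 3)) :
    cknA r ((T, x₀) : ℝ × EuclideanSpace ℝ (Fin 3)) U ≤
      cknAEss r ((T, x₀) : ℝ × EuclideanSpace ℝ (Fin 3)) U := by
  rw [cknA, cknAEss]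
  refine iSup₂_le fun t ht => le_essSup_Ioo_of_seq_lsc ht fun s hs hst => ?_
  have hIo : Ioo (T - r ^ 2) T ⊆ Ico 0 T := fun s' hs' => ⟨by linarith [hs'.1], hs'.2⟩
  exact scaledEnergy_le_liminf hr hcont x₀ (hIo ht) (fun n => hIo (hs n)) hst

/-- **STUB `stub_finalTimeTypeISingularPoint`** (known mathematics: "one scaled energy quantity
bounded ⇒ all bounded", Seregin 2006 / Seregin 2020, remark after Def. 1.7, in the tree as
`Seregin2020.scaledEnergies_bounded_of_cknC_le`; regular points are points of essential
boundedness, CKN 1982, §6). Let `u` be a classical solution of Navier–Stokes (`ν = 1`, no force)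
on `ℝ³ × [0, T)`, Leray–Hopf on `[0, T]`, and `(U, P)` a local energy solution on
`ℝ³ × (0, T')`, `T < T'`, agreeing on `[0, T]` with `u` and its gauged pressure
`q = p − (p(·, 0) − p̃[u](0))`. If `C(r; T, x₀) ≤ M'` for `0 < r < r₁` and `u` is bounded on no
`(T − ρ², T) × B_ρ(x₀)`, then `(T, x₀)` is a centred Type-I singular point of `(U, P)` on the
open slab `(0, T') × ℝ³`. -/
theorem stub_finalTimeTypeISingularPoint :
    ∀ M' T T' : ℝ, 0 < T → T < T' →
      ∀ (u : ℝ → EuclideanSpace ℝ (Fin 3) → EuclideanSpace ℝ (Fin 3))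
        (p : ℝ → EuclideanSpace ℝ (Fin 3) → ℝ)
        (U : ℝ → EuclideanSpace ℝ (Fin 3) → EuclideanSpace ℝ (Fin 3))
        (P : ℝ → EuclideanSpace ℝ (Fin 3) → ℝ),
        Literature.Analysis.FluidPDE.IsClassicalNSSolutionOn (Set.Ico 0 T) 1 0 u p →
        Literature.Analysis.FluidPDE.IsLerayHopfOn T 1 0 (u 0) u →
        Literature.Analysis.FluidPDE.IsLocalEnergySolutionOn T' 1 (u 0) U P →
        (∀ t ∈ Set.Icc 0 T, U t = u t ∧
          P t = fun x => p t x - (p t 0 - Literature.Analysis.FluidPDE.normalisedPressure (u t) 0)) →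
        ∀ x₀ : EuclideanSpace ℝ (Fin 3),
          (∃ r₁ : ℝ, 0 < r₁ ∧ ∀ r ∈ Set.Ioo 0 r₁,
            Literature.Analysis.FluidPDE.cknC r ((T, x₀) : ℝ × EuclideanSpace ℝ (Fin 3)) u ≤ ENNReal.ofReal M') →
          (¬ ∃ ρ : ℝ, 0 < ρ ∧ ∃ M : ℝ, ∀ t ∈ Set.Ioo (T - ρ ^ 2) T, ∀ x ∈ Metric.ball x₀ ρ, ‖u t x‖ ≤ M) →
          Literature.Analysis.FluidPDE.IsTypeISingularPoint
            (Literature.Analysis.FluidPDE.slab (EuclideanSpace ℝ (Fin 3)) (Set.Ioo 0 T') isOpen_Ioo)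
            U P ((T, x₀) : ℝ × EuclideanSpace ℝ (Fin 3)) := by
  rintro M' T T' hT hTT' u p U P hcl hLH hU hagree x₀ ⟨r₁, hr₁, hTI⟩ hnb
  -- ### Step 0: `U = u` below `T`; `U` is continuous on `[0, T) × ℝ³`
  have hUu : ∀ {r : ℝ}, r ^ 2 ≤ T →
      ∀ w ∈ parabolicCylinder r ((T, x₀) : ℝ × EuclideanSpace ℝ (Fin 3)), U w.1 w.2 = u w.1 w.2 :=
    fun hr w hw => by rw [(hagree w.1 (fst_mem_Icc_of_mem_parabolicCylinder hr hw)).1]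
  have hPq : ∀ {r : ℝ}, r ^ 2 ≤ T →
      ∀ w ∈ parabolicCylinder r ((T, x₀) : ℝ × EuclideanSpace ℝ (Fin 3)),
        P w.1 w.2 = p w.1 w.2 - (p w.1 0 - normalisedPressure (u w.1) 0) :=
    fun hr w hw => by rw [(hagree w.1 (fst_mem_Icc_of_mem_parabolicCylinder hr hw)).2]
  have hcontU : ContinuousOn (uncurry U) (Ico 0 T ×ˢ (univ : Set (EuclideanSpace ℝ (Fin 3)))) := by
    refine (SereginSverak2002.continuousOn_uncurry hcl).congr fun w hw => ?_
    show U w.1 w.2 = u w.1 w.2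
    rw [(hagree w.1 ⟨hw.1.1, hw.1.2.le⟩).1]
  -- ### Step 1: `(T, x₀)` is not a regular point of `U`
  have hnotreg : ¬ IsRegularPoint U ((T, x₀) : ℝ × EuclideanSpace ℝ (Fin 3)) := by
    rintro ⟨s, hs, hfin⟩
    set ρ : ℝ := min s (Real.sqrt T)
    have hρ : 0 < ρ := lt_min hs (Real.sqrt_pos.2 hT)
    have hρs : ρ ≤ s := min_le_left _ _
    have hρT : ρ ^ 2 ≤ T := by
      calc ρ ^ 2 ≤ Real.sqrt T ^ 2 := pow_le_pow_left₀ hρ.le (min_le_right _ _) 2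
        _ = T := Real.sq_sqrt hT.le
    have hVs : parabolicCylinder ρ ((T, x₀) : ℝ × EuclideanSpace ℝ (Fin 3)) ⊆
        parabolicCylinderCentered s ((T, x₀) : ℝ × EuclideanSpace ℝ (Fin 3)) := by
      intro w hw
      simp only [mem_parabolicCylinder] at hw
      simp only [mem_parabolicCylinderCentered]
      have h2 : ρ ^ 2 ≤ s ^ 2 := pow_le_pow_left₀ hρ.le hρs 2
      exact ⟨⟨by linarith [hw.1.1], by linarith [hw.1.2, sq_nonneg s]⟩, hw.2.trans_le hρs⟩
    have hfinV : eLpNorm (uncurry U) ∞ (volume.restrict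
        (parabolicCylinder ρ ((T, x₀) : ℝ × EuclideanSpace ℝ (Fin 3)))) ≠ ∞ :=
      ne_top_of_le_ne_top hfin.ne (eLpNorm_mono_measure _ (Measure.restrict_mono_set _ hVs))
    obtain ⟨N, hN⟩ : ∃ N : ℝ, N = (eLpNorm (uncurry U) ∞ (volume.restrict
        (parabolicCylinder ρ ((T, x₀) : ℝ × EuclideanSpace ℝ (Fin 3))))).toReal := ⟨_, rfl⟩
    have hae : ∀ᵐ w ∂(volume.restrict
        (parabolicCylinder ρ ((T, x₀) : ℝ × EuclideanSpace ℝ (Fin 3)))), ‖uncurry U w‖ ≤ N := by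
      have h1 := ae_le_eLpNormEssSup (μ := volume.restrict
        (parabolicCylinder ρ ((T, x₀) : ℝ × EuclideanSpace ℝ (Fin 3)))) (f := uncurry U)
      rw [eLpNorm_exponent_top] at hfinV
      rw [hN, eLpNorm_exponent_top]
      filter_upwards [h1] with w hw
      exact (toReal_enorm (uncurry U w)) ▸ ENNReal.toReal_mono hfinV hw
    have hcont : ContinuousOn (uncurry U)
        (parabolicCylinder ρ ((T, x₀) : ℝ × EuclideanSpace ℝ (Fin 3))) :=
      hcontU.mono ((parabolicCylinder_subset_Ioo_prod hρT x₀).trans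
        (prod_mono Ioo_subset_Ico_self Subset.rfl))
    have hall := SereginSverak2002.norm_le_of_ae_restrict_of_continuousOn
      (isOpen_parabolicCylinder ρ _) hcont hae
    refine hnb ⟨ρ, hρ, N, fun t ht x hx => ?_⟩
    have hw : ((t, x) : ℝ × EuclideanSpace ℝ (Fin 3)) ∈
        parabolicCylinder ρ ((T, x₀) : ℝ × EuclideanSpace ℝ (Fin 3)) := by
      rw [mem_parabolicCylinder]
      exact ⟨⟨ht.1, ht.2⟩, mem_ball.1 hx⟩
    rw [← hUu hρT (t, x) hw]
    exact hall (t, x) hw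
  -- ### Step 2: the weak gradient and the restriction to the slab `(0, T) × ℝ³`
  obtain ⟨G, hG, -⟩ := hU.uniformLocalGradient
  have hle : (slab (EuclideanSpace ℝ (Fin 3)) (Ioo 0 T) isOpen_Ioo :
      TopologicalSpace.Opens (ℝ × EuclideanSpace ℝ (Fin 3))) ≤
        slab (EuclideanSpace ℝ (Fin 3)) (Ioo 0 T') isOpen_Ioo :=
    slab_mono (Ioo_subset_Ioo_right hTT'.le)
  have hsw₀ : IsSuitableWeakSolutionOn
      (slab (EuclideanSpace ℝ (Fin 3)) (Ioo 0 T) isOpen_Ioo) 1 0 U P := hU.suitable.of_le hle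
  have hG₀ : HasWeakSpatialGradientOn
      (slab (EuclideanSpace ℝ (Fin 3)) (Ioo 0 T) isOpen_Ioo) U G := hG.mono hle
  -- ### Step 3: the scale `rI`, with `Q_{rI}(T, x₀)` inside the slab, `D(rI) < ∞`, `C ≤ M'`
  set rI : ℝ := min (r₁ / 2) (Real.sqrt T)
  have hrI : 0 < rI := lt_min (half_pos hr₁) (Real.sqrt_pos.2 hT)
  have hrIr₁ : rI < r₁ := (min_le_left _ _).trans_lt (half_lt_self hr₁)
  have hrIT : rI ^ 2 ≤ T := by
    calc rI ^ 2 ≤ Real.sqrt T ^ 2 := pow_le_pow_left₀ hrI.le (min_le_right _ _) 2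
      _ = T := Real.sq_sqrt hT.le
  have hsubI0 : parabolicCylinder rI ((T, x₀) : ℝ × EuclideanSpace ℝ (Fin 3)) ⊆
      Ioo 0 T ×ˢ (univ : Set (EuclideanSpace ℝ (Fin 3))) :=
    parabolicCylinder_subset_Ioo_prod hrIT x₀
  have hsubI : parabolicCylinder rI ((T, x₀) : ℝ × EuclideanSpace ℝ (Fin 3)) ⊆
      ((slab (EuclideanSpace ℝ (Fin 3)) (Ioo 0 T) isOpen_Ioo :
        TopologicalSpace.Opens (ℝ × EuclideanSpace ℝ (Fin 3))) :
          Set (ℝ × EuclideanSpace ℝ (Fin 3))) :=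
    hsubI0.trans (coe_slab _ _).symm.subset
  have hqint := SereginSverak2002.lintegral_slab_gauged_pressure_lt_top one_pos hT hcl hLH
  have hDI : cknD rI ((T, x₀) : ℝ × EuclideanSpace ℝ (Fin 3)) P ≠ ∞ := by
    rw [cknD]
    refine ENNReal.mul_ne_top
      (ENNReal.inv_ne_top.2 (pow_ne_zero _ (ENNReal.ofReal_pos.2 hrI).ne')) ?_
    refine ne_top_of_le_ne_top hqint.ne ?_
    calc ∫⁻ w in parabolicCylinder rI ((T, x₀) : ℝ × EuclideanSpace ℝ (Fin 3)),
          ‖P w.1 w.2‖ₑ ^ (3 / 2 : ℝ)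
        = ∫⁻ w in parabolicCylinder rI ((T, x₀) : ℝ × EuclideanSpace ℝ (Fin 3)),
            ‖p w.1 w.2 - (p w.1 0 - normalisedPressure (u w.1) 0)‖ₑ ^ (3 / 2 : ℝ) :=
          setLIntegral_congr_fun (isOpen_parabolicCylinder rI _).measurableSet fun w hw => by
            simp only [hPq hrIT w hw]
      _ ≤ _ := lintegral_mono_set hsubI0
  have hCU : ∀ r ∈ Ioc (0 : ℝ) rI,
      cknC r ((T, x₀) : ℝ × EuclideanSpace ℝ (Fin 3)) U ≤ ((M'.toNNReal : ℝ≥0) : ℝ≥0∞) := by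
    intro r hr
    have hrT : r ^ 2 ≤ T := (pow_le_pow_left₀ hr.1.le hr.2 2).trans hrIT
    have hCeq : cknC r ((T, x₀) : ℝ × EuclideanSpace ℝ (Fin 3)) U =
        cknC r ((T, x₀) : ℝ × EuclideanSpace ℝ (Fin 3)) u := by
      rw [cknC, cknC]
      congr 1
      exact setLIntegral_congr_fun (isOpen_parabolicCylinder r _).measurableSet fun w hw => by
        simp only [hUu hrT w hw]
    rw [hCeq]
    exact hTI r ⟨hr.1, hr.2.trans_lt hrIr₁⟩
  -- ### Step 4: Seregin's bound `A_ess + E + C + D ≤ K` on `(0, rI/2]`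
  obtain ⟨K, hK⟩ := Seregin2020.scaledEnergies_bounded_of_cknC_le hsw₀ hG₀ hrI hsubI hDI hCU
  -- ### Step 5: assembling the centred Type-I singular point
  refine ⟨hU.suitable, mem_singularSet.2 ⟨mem_slab.2 ⟨hT, hTT'⟩, hnotreg⟩, G, hG, rI / 2,
    half_pos hrI, ?_, ?_⟩
  · calc parabolicCylinder (rI / 2) ((T, x₀) : ℝ × EuclideanSpace ℝ (Fin 3))
        ⊆ parabolicCylinder rI ((T, x₀) : ℝ × EuclideanSpace ℝ (Fin 3)) :=
          parabolicCylinder_mono (half_pos hrI).le (half_le_self hrI.le) _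
      _ ⊆ _ := hsubI
      _ ⊆ _ := hle
  · refine lt_of_le_of_lt (iSup₂_le fun r hr => ?_) (ENNReal.coe_lt_top (r := K))
    have hrI' : r ≤ rI := hr.2.le.trans (half_le_self hrI.le)
    have hrT : r ^ 2 ≤ T := (pow_le_pow_left₀ hr.1.le hrI' 2).trans hrIT
    calc cknSum r ((T, x₀) : ℝ × EuclideanSpace ℝ (Fin 3)) U P G
        = cknA r ((T, x₀) : ℝ × EuclideanSpace ℝ (Fin 3)) U +
            cknC r ((T, x₀) : ℝ × EuclideanSpace ℝ (Fin 3)) U +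
            cknD r ((T, x₀) : ℝ × EuclideanSpace ℝ (Fin 3)) P +
            cknE r ((T, x₀) : ℝ × EuclideanSpace ℝ (Fin 3)) G := rfl
      _ ≤ cknAEss r ((T, x₀) : ℝ × EuclideanSpace ℝ (Fin 3)) U +
            cknC r ((T, x₀) : ℝ × EuclideanSpace ℝ (Fin 3)) U +
            cknD r ((T, x₀) : ℝ × EuclideanSpace ℝ (Fin 3)) P +
            cknE r ((T, x₀) : ℝ × EuclideanSpace ℝ (Fin 3)) G := by
          gcongr
          exact cknA_le_cknAEss_of_continuousOn hr.1 hrT hcontU x₀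
      _ = cknAEss r ((T, x₀) : ℝ × EuclideanSpace ℝ (Fin 3)) U +
            cknE r ((T, x₀) : ℝ × EuclideanSpace ℝ (Fin 3)) G +
            cknC r ((T, x₀) : ℝ × EuclideanSpace ℝ (Fin 3)) U +
            cknD r ((T, x₀) : ℝ × EuclideanSpace ℝ (Fin 3)) P := by ring
      _ ≤ K := hK r ⟨hr.1, hr.2.le⟩

end Summit.NavierStokesRegularity.NavierStokesRegularity.Theorems.SequentialTypeIExclusion.Registered

end
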